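import Summits.QuantumAdvantage.QuantumAdvantage.Theorems.CubicForrelationNearExactIsExactTwelveLevelSixDeltaZeroRadical
import Summits.QuantumAdvantage.QuantumAdvantage.Theorems.CubicForrelationNearExactIsExactTwelveLevelFiveBothDeadAt2932
import Summits.QuantumAdvantage.QuantumAdvantage.Theorems.CubicForrelationNearExactIsExactTwelveLevelSixBothAt2932

/-!
# Crux `CubicForrelation.NearExactIsExact` (stmt-QuantumAdvantage-14043) — n = 12 AT `Φ = 29/32`: the level-6 configuration (δ₀)
  (`e = σ` on `Z ∖ T`, `−3σ` on a 32-set `T`, `0` off the 9-flat `Z`) is DEAD against a level-6 partner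

Certificate seat `b2b-cforr-cert` (gen 23).  HONEST FRAMING: finite-slice lemmas (standard axioms) about cubic Boolean pairs on 12 bits; with
`tw23_boundary_reduction` this removes the whole branch "`8 ∣ e` off `Z`" at the boundary budget, so `29/32` at `n = 12` needs each side in
configuration (β) `#Z = 768` or (γ) `#Z = 512 ∧ E_off = 256`.  NOT decided here; NO new value of `θ₁₂`; NOT summit progress.

THE ARGUMENT (`tw23_levelSix_delta0_false`), the level-6 twin of `tw23_levelFive_R1_false`.  By `d0_frame` / `d0_structure`, `T = t₀ ⊕ R` with
`R = rad B ∩ V₀`, `#R = 32`.  Character sums on the 9-flat: `Ŝ(y) = Σ_{x∈Z} σ(x)(−1)^{x·y}` satisfies `Ŝ² = 512·S_R` (`d0_Shat_sq`: correlations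
vanish off the radical, `d0_corr_zero`, and are constant on it, `fr_radical_period`), where `S_R(y) = Σ_{r∈R} η(r)(−1)^{r·y} ∈ {0, 32}`
(`η(r) = σ(x_Z)σ(x_Z ⊕ r)` is a multiplicative sign on `R`; `bd_hom_sum`); and `T̂_σ = σ(t₀)(−1)^{t₀·y} S_R`.  Hence
`ê = Ŝ − 4T̂_σ ∈ {0, ±256}`, so by duality (`l5k_duality`) the partner's residual `e_f = −ê/64 ∈ {0, ±4}` is EVEN everywhere: `w_f` is odd
everywhere, `|W_f| = 64` everywhere (Parseval), `f` is bent, and `Φ ∈ {1} ∪ (−∞, 7/8]` (`tw_bent_end`) — contradiction.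

References: MacWilliams–Sloane (1977) Ch. 15 §2; O. Rothaus (1976); R. O'Donnell (2014) §1.4.  Axioms: the standard three.
-/

set_option linter.dupNamespace false -- D-0017: single-problem summit ⇒ `QuantumAdvantage.QuantumAdvantage` by design

noncomputable section

namespace Summit.QuantumAdvantage.QuantumAdvantage.Theorems.CubicForrelation.NearExactIsExact

open Finset
open Literature.Computability.QuantumComplexity
open Literature.Computability.QuantumComplexity.BuzetChailloux (bxor zeroVec bxor_bxor_cancel_left bxor_zeroVec zeroVec_bxor bxor_comm
  bxor_self)
open Literature.Computability.QuantumComplexity.DerivativeWalsh (W)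
open Literature.Computability.QuantumComplexity.BuzetChailloux (signOf_sq)
open Literature.Computability.QuantumComplexity.DerivativeWalsh (twist_bxor_left sum_W_sq)
open Literature.Computability.QuantumComplexity.Simon (twist_eq_one_or twist_mul_self)

/-! ### Character sums on the 9-flat -/

/-- Re-basing the coset: `Z = x ⊕ V₀` for every `x ∈ Z`. [folklore] -/
theorem d0_rebase (V₀ S : Finset (Fin (6 + 6) → Bool)) (xZ : Fin (6 + 6) → Bool)
    (hadd : ∀ a ∈ V₀, ∀ b ∈ V₀, bxor a b ∈ V₀) (hS : S = V₀.image (bxor xZ)) {x : Fin (6 + 6) → Bool} (hx : x ∈ S) :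
    S = V₀.image (bxor x) := by
  have hxv : bxor xZ x ∈ V₀ := fl1_coset_diff hS hx
  ext y
  rw [hS, mem_image, mem_image]
  constructor
  · rintro ⟨v, hv, rfl⟩
    refine ⟨bxor (bxor xZ x) v, hadd _ hxv _ hv, ?_⟩
    funext j; simp only [bxor]; cases xZ j <;> cases x j <;> cases v j <;> rfl
  · rintro ⟨v, hv, rfl⟩
    refine ⟨bxor (bxor xZ x) v, hadd _ hxv _ hv, ?_⟩
    funext j; simp only [bxor]; cases xZ j <;> cases x j <;> cases v j <;> rfl

/-- **Correlation along a non-radical direction vanishes** (coset form): if `B(t,v) = 1` for some `v ∈ V₀` then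
`Σ_{x∈Z} σ(x)σ(x⊕t) = 0`. [this work] -/
theorem d0_corr_zero (V₀ : Finset (Fin (6 + 6) → Bool)) (u'' : (Fin (6 + 6) → Bool) → ℤ) (xZ : Fin (6 + 6) → Bool)
    (hadd : ∀ a ∈ V₀, ∀ b ∈ V₀, bxor a b ∈ V₀) (hS : (univ.filter fun x : Fin (6 + 6) → Bool => ¬ Odd (u'' x)) = V₀.image (bxor xZ)) (hb : (Fin (6 + 6) → Bool) → Bool)
    (hsd : ∀ x, x ∈ (univ.filter fun x : Fin (6 + 6) → Bool => ¬ Odd (u'' x)) → ∀ p ∈ V₀, ∀ q ∈ V₀, hb (bxor (bxor x p) q) =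
      (hb x ^^ hb (bxor x p) ^^ hb (bxor x q) ^^ (hb xZ ^^ hb (bxor xZ p) ^^ hb (bxor xZ q) ^^ hb (bxor (bxor xZ p) q))))
    (t v : Fin (6 + 6) → Bool) (ht : t ∈ V₀) (hv : v ∈ V₀) (htv : (hb xZ ^^ hb (bxor xZ t) ^^ hb (bxor xZ v) ^^ hb (bxor (bxor xZ t) v)) = true) :
    ∑ x ∈ (univ.filter fun x : Fin (6 + 6) → Bool => ¬ Odd (u'' x)), signOf (hb x) * signOf (hb (bxor x t)) = 0 := by
  have hPV : ∀ x, x ∈ (univ.filter fun x : Fin (6 + 6) → Bool => ¬ Odd (u'' x)) → ∀ a ∈ V₀, bxor x a ∈ (univ.filter fun x : Fin (6 + 6) → Bool => ¬ Odd (u'' x)) := fun x hx a ha => fl1_coset_vadd hadd hS hx ha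
  have hvt : (hb xZ ^^ hb (bxor xZ v) ^^ hb (bxor xZ t) ^^ hb (bxor (bxor xZ v) t)) = true := by rw [fr_B_symm xZ hb v t]; exact htv
  have hflip : ∀ x ∈ (univ.filter fun x : Fin (6 + 6) → Bool => ¬ Odd (u'' x)), signOf (hb (bxor x v)) * signOf (hb (bxor (bxor x v) t)) = -(signOf (hb x) * signOf (hb (bxor x t))) := by
    intro x hx
    rw [hsd x hx v hv t ht, hvt]
    cases hb x <;> cases hb (bxor x v) <;> cases hb (bxor x t) <;> simp [signOf]
  have h := gr20_sum_translate (S := (univ.filter fun x : Fin (6 + 6) → Bool => ¬ Odd (u'' x))) (v := v) (fun x hx => hPV x hx v hv) (fun x => signOf (hb x) * signOf (hb (bxor x t)))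
  rw [sum_congr rfl fun x hx => hflip x hx, sum_neg_distrib] at h
  linarith

/-- **`Ŝ(y)² = 512·S_R(y)`** on the 9-flat (coset form of `gr20_Shat_sq`). [this work] -/
theorem d0_Shat_sq (V₀ : Finset (Fin (6 + 6) → Bool)) (u'' : (Fin (6 + 6) → Bool) → ℤ) (xZ : Fin (6 + 6) → Bool) (h0 : zeroVec ∈ V₀)
    (hadd : ∀ a ∈ V₀, ∀ b ∈ V₀, bxor a b ∈ V₀) (hcardV : #V₀ = 512) (hS : (univ.filter fun x : Fin (6 + 6) → Bool => ¬ Odd (u'' x)) = V₀.image (bxor xZ))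
    (hb : (Fin (6 + 6) → Bool) → Bool)
    (hsd : ∀ x, x ∈ (univ.filter fun x : Fin (6 + 6) → Bool => ¬ Odd (u'' x)) → ∀ p ∈ V₀, ∀ q ∈ V₀, hb (bxor (bxor x p) q) =
      (hb x ^^ hb (bxor x p) ^^ hb (bxor x q) ^^ (hb xZ ^^ hb (bxor xZ p) ^^ hb (bxor xZ q) ^^ hb (bxor (bxor xZ p) q))))
    (y : Fin (6 + 6) → Bool) :
    (∑ x ∈ (univ.filter fun x : Fin (6 + 6) → Bool => ¬ Odd (u'' x)), signOf (hb x) * twist x y) ^ 2 =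
      512 * ∑ t ∈ (V₀.filter fun r => ∀ v ∈ V₀, (hb xZ ^^ hb (bxor xZ r) ^^ hb (bxor xZ v) ^^ hb (bxor (bxor xZ r) v)) = false), signOf (hb xZ ^^ hb (bxor xZ t)) * twist t y := by
  classical
  have hxZ : xZ ∈ (univ.filter fun x : Fin (6 + 6) → Bool => ¬ Odd (u'' x)) := by rw [hS]; exact mem_image.2 ⟨zeroVec, h0, bxor_zeroVec xZ⟩
  have hVP : ∀ x, x ∈ (univ.filter fun x : Fin (6 + 6) → Bool => ¬ Odd (u'' x)) → bxor xZ x ∈ V₀ := fun x hx => fl1_coset_diff hS hx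
  have hZcard : #(univ.filter fun x : Fin (6 + 6) → Bool => ¬ Odd (u'' x)) = 512 := by
    rw [hS, card_image_of_injective _ (fun y y' hyy => by
      have h' := congrArg (bxor xZ) hyy
      rwa [bxor_bxor_cancel_left, bxor_bxor_cancel_left] at h'), hcardV]
  rw [sq, sum_mul_sum]
  have hinner : ∀ x ∈ (univ.filter fun x : Fin (6 + 6) → Bool => ¬ Odd (u'' x)), ∑ x' ∈ (univ.filter fun x : Fin (6 + 6) → Bool => ¬ Odd (u'' x)), signOf (hb x) * twist x y * (signOf (hb x') * twist x' y) =
      ∑ t ∈ V₀, twist t y * (signOf (hb x) * signOf (hb (bxor x t))) := by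
    intro x hx
    rw [d0_rebase V₀ _ xZ hadd hS hx, sum_image (fun a _ b _ h => by
      have h' := congrArg (bxor x) h
      rwa [bxor_bxor_cancel_left, bxor_bxor_cancel_left] at h')]
    refine sum_congr rfl fun t _ => ?_
    rw [twist_bxor_left]
    have h1 := twist_mul_self x y
    linear_combination (signOf (hb x) * signOf (hb (bxor x t)) * twist t y) * h1
  rw [sum_congr rfl hinner, sum_comm]
  have hRsub : (V₀.filter fun r => ∀ v ∈ V₀, (hb xZ ^^ hb (bxor xZ r) ^^ hb (bxor xZ v) ^^ hb (bxor (bxor xZ r) v)) = false) ⊆ V₀ := filter_subset _ _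
  rw [← sum_filter_add_sum_filter_not V₀ (fun t => t ∈ (V₀.filter fun r => ∀ v ∈ V₀, (hb xZ ^^ hb (bxor xZ r) ^^ hb (bxor xZ v) ^^ hb (bxor (bxor xZ r) v)) = false))]
  have e1 : V₀.filter (fun t => t ∈ (V₀.filter fun r => ∀ v ∈ V₀, (hb xZ ^^ hb (bxor xZ r) ^^ hb (bxor xZ v) ^^ hb (bxor (bxor xZ r) v)) = false)) = (V₀.filter fun r => ∀ v ∈ V₀, (hb xZ ^^ hb (bxor xZ r) ^^ hb (bxor xZ v) ^^ hb (bxor (bxor xZ r) v)) = false) := by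
    ext t; simp only [mem_filter]; exact ⟨fun h => h.2, fun h => ⟨h.1, h⟩⟩
  rw [e1]
  have hzero : ∑ t ∈ V₀.filter (fun t => t ∉ (V₀.filter fun r => ∀ v ∈ V₀, (hb xZ ^^ hb (bxor xZ r) ^^ hb (bxor xZ v) ^^ hb (bxor (bxor xZ r) v)) = false)),
      ∑ x ∈ (univ.filter fun x : Fin (6 + 6) → Bool => ¬ Odd (u'' x)), twist t y * (signOf (hb x) * signOf (hb (bxor x t))) = 0 := by
    refine sum_eq_zero fun t ht => ?_
    obtain ⟨htV, htR⟩ := mem_filter.1 ht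
    have hex : ∃ v ∈ V₀, (hb xZ ^^ hb (bxor xZ t) ^^ hb (bxor xZ v) ^^ hb (bxor (bxor xZ t) v)) = true := by
      by_contra h
      push Not at h
      exact htR (mem_filter.2 ⟨htV, fun v hv => by simpa using h v hv⟩)
    obtain ⟨v, hv, htv⟩ := hex
    rw [← mul_sum, d0_corr_zero V₀ u'' xZ hadd hS hb hsd t v htV hv htv, mul_zero]
  rw [hzero, add_zero, mul_sum]
  refine sum_congr rfl fun t ht => ?_
  have hper : ∀ x ∈ (univ.filter fun x : Fin (6 + 6) → Bool => ¬ Odd (u'' x)), hb (bxor x t) = (hb x ^^ (hb xZ ^^ hb (bxor xZ t))) :=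
    fun x hx => fr_radical_period V₀ (· ∈ (univ.filter fun x : Fin (6 + 6) → Bool => ¬ Odd (u'' x))) xZ hb hxZ hVP hsd ht hx
  have hconst : ∀ x ∈ (univ.filter fun x : Fin (6 + 6) → Bool => ¬ Odd (u'' x)), twist t y * (signOf (hb x) * signOf (hb (bxor x t))) = signOf (hb xZ ^^ hb (bxor xZ t)) * twist t y := by
    intro x hx
    rw [hper x hx]
    cases hb x <;> cases hb xZ <;> cases hb (bxor xZ t) <;> simp [signOf]
  rw [sum_congr rfl hconst, sum_const, hZcard, nsmul_eq_mul]
  push_cast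
  ring

/-- **`S_R(y) ∈ {0, 32}`** when `#R = 32`: `η(r)(−1)^{r·y}` is a multiplicative sign on the group `R` (`bd_hom_sum`). [this work] -/
theorem d0_SR (V₀ : Finset (Fin (6 + 6) → Bool)) (u'' : (Fin (6 + 6) → Bool) → ℤ) (xZ : Fin (6 + 6) → Bool) (h0 : zeroVec ∈ V₀)
    (hadd : ∀ a ∈ V₀, ∀ b ∈ V₀, bxor a b ∈ V₀) (hS : (univ.filter fun x : Fin (6 + 6) → Bool => ¬ Odd (u'' x)) = V₀.image (bxor xZ))
    (hb : (Fin (6 + 6) → Bool) → Bool)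
    (hsd : ∀ x, x ∈ (univ.filter fun x : Fin (6 + 6) → Bool => ¬ Odd (u'' x)) → ∀ p ∈ V₀, ∀ q ∈ V₀, hb (bxor (bxor x p) q) =
      (hb x ^^ hb (bxor x p) ^^ hb (bxor x q) ^^ (hb xZ ^^ hb (bxor xZ p) ^^ hb (bxor xZ q) ^^ hb (bxor (bxor xZ p) q))))
    (hR32 : #(V₀.filter fun r => ∀ v ∈ V₀, (hb xZ ^^ hb (bxor xZ r) ^^ hb (bxor xZ v) ^^ hb (bxor (bxor xZ r) v)) = false) = 32) (y : Fin (6 + 6) → Bool) :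
    ∑ t ∈ (V₀.filter fun r => ∀ v ∈ V₀, (hb xZ ^^ hb (bxor xZ r) ^^ hb (bxor xZ v) ^^ hb (bxor (bxor xZ r) v)) = false), signOf (hb xZ ^^ hb (bxor xZ t)) * twist t y = 0 ∨
      ∑ t ∈ (V₀.filter fun r => ∀ v ∈ V₀, (hb xZ ^^ hb (bxor xZ r) ^^ hb (bxor xZ v) ^^ hb (bxor (bxor xZ r) v)) = false), signOf (hb xZ ^^ hb (bxor xZ t)) * twist t y = 32 := by
  classical
  have hxZ : xZ ∈ (univ.filter fun x : Fin (6 + 6) → Bool => ¬ Odd (u'' x)) := by rw [hS]; exact mem_image.2 ⟨zeroVec, h0, bxor_zeroVec xZ⟩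
  have hPV : ∀ x, x ∈ (univ.filter fun x : Fin (6 + 6) → Bool => ¬ Odd (u'' x)) → ∀ a ∈ V₀, bxor x a ∈ (univ.filter fun x : Fin (6 + 6) → Bool => ¬ Odd (u'' x)) := fun x hx a ha => fl1_coset_vadd hadd hS hx ha
  have hRadd := fr_radical_add V₀ (· ∈ (univ.filter fun x : Fin (6 + 6) → Bool => ¬ Odd (u'' x))) xZ hb hxZ hPV hadd hsd
  have h1 : ∀ t ∈ (V₀.filter fun r => ∀ v ∈ V₀, (hb xZ ^^ hb (bxor xZ r) ^^ hb (bxor xZ v) ^^ hb (bxor (bxor xZ r) v)) = false), signOf (hb xZ ^^ hb (bxor xZ t)) * twist t y = 1 ∨ signOf (hb xZ ^^ hb (bxor xZ t)) * twist t y = -1 := by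
    intro t _
    rcases twist_eq_one_or t y with h | h <;> cases (hb xZ ^^ hb (bxor xZ t)) <;> simp [signOf, h]
  have hmul : ∀ t ∈ (V₀.filter fun r => ∀ v ∈ V₀, (hb xZ ^^ hb (bxor xZ r) ^^ hb (bxor xZ v) ^^ hb (bxor (bxor xZ r) v)) = false), ∀ s ∈ (V₀.filter fun r => ∀ v ∈ V₀, (hb xZ ^^ hb (bxor xZ r) ^^ hb (bxor xZ v) ^^ hb (bxor (bxor xZ r) v)) = false),
      signOf (hb xZ ^^ hb (bxor xZ (bxor t s))) * twist (bxor t s) y = (signOf (hb xZ ^^ hb (bxor xZ t)) * twist t y) * (signOf (hb xZ ^^ hb (bxor xZ s)) * twist s y) := by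
    intro t ht s hs
    have htV : t ∈ V₀ := (mem_filter.1 ht).1
    have hsV : s ∈ V₀ := (mem_filter.1 hs).1
    have hts : (hb xZ ^^ hb (bxor xZ t) ^^ hb (bxor xZ s) ^^ hb (bxor (bxor xZ t) s)) = false := (mem_filter.1 ht).2 s hsV
    rw [twist_bxor_left, ← iw_bxor_assoc xZ t s, hsd xZ hxZ t htV s hsV, hts]
    cases hb xZ <;> cases hb (bxor xZ t) <;> cases hb (bxor xZ s) <;> simp [signOf]
  rcases bd_hom_sum (V₀.filter fun r => ∀ v ∈ V₀, (hb xZ ^^ hb (bxor xZ r) ^^ hb (bxor xZ v) ^^ hb (bxor (bxor xZ r) v)) = false) hRadd (fun t => signOf (hb xZ ^^ hb (bxor xZ t)) * twist t y) h1 hmul with h | h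
  · exact Or.inl h
  · right; rw [h, hR32]; norm_num

/-! ### The kill -/

/-- **Configuration (δ₀) is DEAD against a level-6 partner** (12 bits): cubic `f, g` with `W_g = 64u''`, `W_f = 64w_f`, `7/8 < Φ(f,g) < 1`,
`Z = {u'' even}` a 9-flat, `e = u'' − (−1)^f = 0` off `Z` and `e ∈ {σ, −3σ}` on `Z` (`σ = (−1)^{hb}`) with exactly `32` points of `−3σ`
— impossible.  NOT summit progress. [this work] -/
theorem tw23_levelSix_delta0_false (f g : (Fin (6 + 6) → Bool) → Bool) (hf : IsDegLeFun 3 f) (hg : IsDegLeFun 3 g)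
    (u'' : (Fin (6 + 6) → Bool) → ℤ) (hu'' : ∀ x, W (fun y => signOf (g y)) x = (2 : ℝ) ^ 6 * (u'' x : ℝ))
    (V₀ : Finset (Fin (6 + 6) → Bool)) (xZ : Fin (6 + 6) → Bool) (h0 : zeroVec ∈ V₀) (hadd : ∀ a ∈ V₀, ∀ b ∈ V₀, bxor a b ∈ V₀)
    (hcardV : #V₀ = 512) (hS : (univ.filter fun x : Fin (6 + 6) → Bool => ¬ Odd (u'' x)) = V₀.image (bxor xZ))
    (hoff0 : ∀ y, y ∉ (univ.filter fun x : Fin (6 + 6) → Bool => ¬ Odd (u'' x)) → (u'' y - sZ (f y)) = 0)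
    (hb : (Fin (6 + 6) → Bool) → Bool)
    (hvals : ∀ x ∈ (univ.filter fun x : Fin (6 + 6) → Bool => ¬ Odd (u'' x)), (u'' x - sZ (f x)) = sZ (hb x) ∨ (u'' x - sZ (f x)) = -3 * sZ (hb x))
    (hT : #((univ.filter fun x : Fin (6 + 6) → Bool => ¬ Odd (u'' x)).filter fun x => (u'' x - sZ (f x)) = -3 * sZ (hb x)) = 32)
    (wf : (Fin (6 + 6) → Bool) → ℤ) (hwf : ∀ y, W (fun x => signOf (f x)) y = (2 : ℝ) ^ 6 * (wf y : ℝ))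
    (hlo : (7 / 8 : ℝ) < forrelation f g) (hhi : forrelation f g < 1) : False := by
  classical
  have hxZ : xZ ∈ (univ.filter fun x : Fin (6 + 6) → Bool => ¬ Odd (u'' x)) := by rw [hS]; exact mem_image.2 ⟨zeroVec, h0, bxor_zeroVec xZ⟩
  have hVP : ∀ x, x ∈ (univ.filter fun x : Fin (6 + 6) → Bool => ¬ Odd (u'' x)) → bxor xZ x ∈ V₀ := fun x hx => fl1_coset_diff hS hx
  have hsd := d0_hsd f g hf hg u'' hu'' V₀ xZ h0 hadd hcardV hS hoff0 hb hvals
  obtain ⟨a₀, ha₀, a₁, ha₁, a₂, ha₂, a₃, ha₃, hPf⟩ := d0_frame f g hf hg u'' hu'' V₀ xZ h0 hadd hcardV hS hoff0 hb hvals hT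
  obtain ⟨t₀, ht₀⟩ : ((univ.filter fun x : Fin (6 + 6) → Bool => ¬ Odd (u'' x)).filter fun x => (u'' x - sZ (f x)) = -3 * sZ (hb x)).Nonempty := by rw [← card_pos, hT]; norm_num
  have ht₀' := mem_filter.1 ht₀
  obtain ⟨hR32, hTeq⟩ := d0_structure f g hf hg u'' hu'' V₀ xZ h0 hadd hcardV hS hoff0 hb hvals hT ha₀ ha₁ ha₂ ha₃ hPf t₀ ht₀'
  set R := (V₀.filter fun r => ∀ v ∈ V₀, (hb xZ ^^ hb (bxor xZ r) ^^ hb (bxor xZ v) ^^ hb (bxor (bxor xZ r) v)) = false) with hR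
  set Z := (univ.filter fun x : Fin (6 + 6) → Bool => ¬ Odd (u'' x)) with hZdef
  have hmemZ : ∀ x, x ∈ Z ↔ ¬ Odd (u'' x) := fun x => by simp [hZdef]
  -- duality `ê = −64 e_f`
  have hu' : ∀ x, W (fun y => signOf (g y)) x = (2 : ℝ) ^ 5 * (((2 * u'' x : ℤ)) : ℝ) := fun x => by rw [hu'' x]; push_cast; ring
  have huf : ∀ y, W (fun x => signOf (f x)) y = (2 : ℝ) ^ 5 * (((2 * wf y : ℤ)) : ℝ) := fun y => by rw [hwf y]; push_cast; ring
  have hdual : ∀ y, ∑ a, ((((u'' a - sZ (f a))) : ℤ) : ℝ) * twist a y = -64 * (((wf y - sZ (g y) : ℤ)) : ℝ) := by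
    intro y
    have h := l5k_duality f g (fun x => 2 * u'' x) hu' (fun y => 2 * wf y) huf y
    have e2 : ∑ a, (((2 * u'' a - 2 * sZ (f a) : ℤ)) : ℝ) * twist a y = 2 * ∑ a, ((((u'' a - sZ (f a))) : ℤ) : ℝ) * twist a y := by
      rw [mul_sum]; exact sum_congr rfl fun a _ => by push_cast; ring
    rw [e2] at h
    have : ∑ a, ((((u'' a - sZ (f a))) : ℤ) : ℝ) * twist a y = -32 * (((2 * wf y - 2 * sZ (g y) : ℤ)) : ℝ) := by linarith
    rw [this]; push_cast; ring
  -- `ê = Ŝ − 4·T̂_σ`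
  have hη : ∀ r ∈ R, ∀ x ∈ Z, signOf (hb (bxor x r)) = signOf (hb x) * signOf (hb xZ ^^ hb (bxor xZ r)) := by
    intro r hr x hx
    rw [fr_radical_period V₀ (· ∈ Z) xZ hb hxZ hVP hsd hr hx]
    cases hb x <;> cases hb xZ <;> cases hb (bxor xZ r) <;> simp [signOf]
  have hinjt : ∀ a ∈ R, ∀ b ∈ R, bxor t₀ a = bxor t₀ b → a = b := fun a _ b _ h => by
    have h' := congrArg (bxor t₀) h
    rwa [bxor_bxor_cancel_left, bxor_bxor_cancel_left] at h'
  have hE : ∀ y, ∑ a, ((((u'' a - sZ (f a))) : ℤ) : ℝ) * twist a y =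
      (∑ x ∈ Z, signOf (hb x) * twist x y) - 4 * (signOf (hb t₀) * twist t₀ y * ∑ r ∈ R, signOf (hb xZ ^^ hb (bxor xZ r)) * twist r y) := by
    intro y
    have h1 : ∑ a, ((((u'' a - sZ (f a))) : ℤ) : ℝ) * twist a y = ∑ x ∈ Z, ((((u'' x - sZ (f x))) : ℤ) : ℝ) * twist x y := by
      rw [← sum_filter_add_sum_filter_not univ (fun x : Fin (6 + 6) → Bool => ¬ Odd (u'' x))]
      have hz : ∑ x ∈ univ.filter (fun x : Fin (6 + 6) → Bool => ¬ ¬ Odd (u'' x)), ((((u'' x - sZ (f x))) : ℤ) : ℝ) * twist x y = 0 :=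
        sum_eq_zero fun x hx => by
          have hx' : x ∉ Z := fun h => (mem_filter.1 hx).2 ((hmemZ x).1 h)
          rw [hoff0 x hx']; simp
      rw [hz, add_zero]
    have h2 : ∀ x ∈ Z, ((((u'' x - sZ (f x))) : ℤ) : ℝ) * twist x y =
        signOf (hb x) * twist x y - 4 * (if x ∈ ((univ.filter fun x : Fin (6 + 6) → Bool => ¬ Odd (u'' x)).filter fun x => (u'' x - sZ (f x)) = -3 * sZ (hb x)) then signOf (hb x) * twist x y else 0) := by
      intro x hx
      rcases hvals x hx with h | h
      · have hnot : x ∉ ((univ.filter fun x : Fin (6 + 6) → Bool => ¬ Odd (u'' x)).filter fun x => (u'' x - sZ (f x)) = -3 * sZ (hb x)) := by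
          rw [mem_filter]; rintro ⟨-, h'⟩
          rcases tp_sZ_cases (hb x) with hs | hs <;> rw [hs] at h h' <;> omega
        rw [if_neg hnot, h, tp_sZ_cast]; ring
      · have hmem : x ∈ ((univ.filter fun x : Fin (6 + 6) → Bool => ¬ Odd (u'' x)).filter fun x => (u'' x - sZ (f x)) = -3 * sZ (hb x)) := mem_filter.2 ⟨hx, h⟩
        rw [if_pos hmem, h]; push_cast; rw [tp_sZ_cast]; ring
    have hTsum : ∑ x ∈ ((univ.filter fun x : Fin (6 + 6) → Bool => ¬ Odd (u'' x)).filter fun x => (u'' x - sZ (f x)) = -3 * sZ (hb x)), signOf (hb x) * twist x y = signOf (hb t₀) * twist t₀ y * ∑ r ∈ R, signOf (hb xZ ^^ hb (bxor xZ r)) * twist r y := by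
      rw [hTeq, sum_image hinjt, mul_sum]
      refine sum_congr rfl fun r hr => ?_
      rw [twist_bxor_left t₀ r y, hη r hr t₀ ht₀'.1]; ring
    have hsub : ((univ.filter fun x : Fin (6 + 6) → Bool => ¬ Odd (u'' x)).filter fun x => (u'' x - sZ (f x)) = -3 * sZ (hb x)) ⊆ Z := filter_subset _ _
    rw [h1, sum_congr rfl h2, sum_sub_distrib, ← mul_sum, ← sum_filter, (filter_mem_eq_inter).trans (inter_eq_right.2 hsub), hTsum]
  -- hence `ê ∈ {0, ±256}`
  have hvals256 : ∀ y, ∑ a, ((((u'' a - sZ (f a))) : ℤ) : ℝ) * twist a y = 0 ∨ ∑ a, ((((u'' a - sZ (f a))) : ℤ) : ℝ) * twist a y = 256 ∨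
      ∑ a, ((((u'' a - sZ (f a))) : ℤ) : ℝ) * twist a y = -256 := by
    intro y
    have hSq := d0_Shat_sq V₀ u'' xZ h0 hadd hcardV hS hb hsd y
    rw [hE y]
    rcases d0_SR V₀ u'' xZ h0 hadd hS hb hsd hR32 y with h | h
    · left
      rw [h, mul_zero] at hSq
      rw [h, pow_eq_zero_iff two_ne_zero |>.1 hSq]; ring
    · rw [h] at hSq ⊢
      have hS2 : (∑ x ∈ Z, signOf (hb x) * twist x y - 128) * (∑ x ∈ Z, signOf (hb x) * twist x y + 128) = 0 := by nlinarith
      have hst : signOf (hb t₀) * twist t₀ y = 1 ∨ signOf (hb t₀) * twist t₀ y = -1 := by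
        rcases twist_eq_one_or t₀ y with h' | h' <;> cases hb t₀ <;> simp [signOf, h']
      rcases mul_eq_zero.1 hS2 with h3 | h3 <;> rcases hst with h4 | h4 <;> rw [h4]
      · left; linarith
      · right; left; linarith
      · right; right; linarith
      · left; linarith
  -- so the partner's residual is even everywhere: `w_f` odd everywhere
  have hwodd : ∀ y, Odd (wf y) := by
    intro y
    have hd := hdual y
    have hs : sZ (g y) = 1 ∨ sZ (g y) = -1 := tp_sZ_cases _
    rw [Int.odd_iff]
    rcases hvals256 y with h | h | h <;> rw [h] at hd
    · have : (((wf y - sZ (g y) : ℤ)) : ℝ) = 0 := by linarith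
      have h0 : wf y - sZ (g y) = 0 := by exact_mod_cast this
      rcases hs with h1 | h1 <;> omega
    · have : (((wf y - sZ (g y) : ℤ)) : ℝ) = -4 := by linarith
      have h0 : wf y - sZ (g y) = -4 := by exact_mod_cast this
      rcases hs with h1 | h1 <;> omega
    · have : (((wf y - sZ (g y) : ℤ)) : ℝ) = 4 := by linarith
      have h0 : wf y - sZ (g y) = 4 := by exact_mod_cast this
      rcases hs with h1 | h1 <;> omega
  -- `f` is bent: contradiction with `7/8 < Φ < 1`
  have hge : ∀ y, (2 : ℝ) ^ (6 + 6) ≤ W (fun x => signOf (f x)) y ^ 2 := by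
    intro y
    rw [hwf y, mul_pow]
    have h1 : (1 : ℝ) ≤ (wf y : ℝ) ^ 2 := by
      have h0 := Int.odd_iff.1 (hwodd y)
      have : wf y ≤ -1 ∨ 1 ≤ wf y := by omega
      have h2 : (1 : ℤ) ≤ wf y ^ 2 := by rcases this with h | h <;> nlinarith
      exact_mod_cast h2
    calc (2 : ℝ) ^ (6 + 6) = ((2 : ℝ) ^ 6) ^ 2 * 1 := by norm_num
      _ ≤ ((2 : ℝ) ^ 6) ^ 2 * ((wf y : ℝ)) ^ 2 := by gcongr
  have hpar : ∑ y, W (fun x => signOf (f x)) y ^ 2 = (2 : ℝ) ^ (6 + 6) * 2 ^ (6 + 6) := by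
    rw [sum_W_sq]
    have : ∑ x : Fin (6 + 6) → Bool, signOf (f x) ^ 2 = 2 ^ (6 + 6) := by
      simp_rw [signOf_sq]; rw [sum_const, card_univ, Fintype.card_fun, Fintype.card_bool, Fintype.card_fin]; norm_num
    rw [this]
  have hbent : ∀ y, W (fun x => signOf (f x)) y ^ 2 = (2 : ℝ) ^ (6 + 6) := by
    have hsum : ∑ y : Fin (6 + 6) → Bool, (2 : ℝ) ^ (6 + 6) = ∑ y, W (fun x => signOf (f x)) y ^ 2 := by
      rw [hpar, sum_const, card_univ, Fintype.card_fun, Fintype.card_bool, Fintype.card_fin]; norm_num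
    have h := (sum_eq_sum_iff_of_le (fun y _ => hge y)).1 hsum
    exact fun y => (h y (mem_univ _)).symm
  have hΦ' : forrelation g f = forrelation f g := by
    rw [Summit.QuantumAdvantage.QuantumAdvantage.Theorems.SignedCubicForrelationNotPrBPP.Negative.HalfQuad.forrelation_comm]
  rcases tw_bent_end (m := 6) (by norm_num) g f hg hf hbent with h | h
  · rw [hΦ'] at h; rw [h] at hhi; exact lt_irrefl _ hhi
  · rw [hΦ'] at h; norm_num at h; linarith

end Summit.QuantumAdvantage.QuantumAdvantage.Theorems.CubicForrelation.NearExactIsExact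

end
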